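import Literature.Analysis.FluidPDE.SereginEpsilonRegularityHigherProofs
import Literature.Analysis.FluidPDE.CKNEpsilonRegularityHolds
import Literature.Analysis.FluidPDE.NSBoundedHigherRegularityQuantProofs
import HarnessLib

/-!
# Seregin 2014, Lemma 6.1 (ε-regularity with all spatial derivatives): `seregin2014_lemma61_holds`

Analysis/FluidPDE proof file (theorems only: no definition, no named fact, no `sorry`).  It composes
reductions that are already in the tree with `NSBoundedHigherRegularityBounds_holds`
(`NSBoundedHigherRegularityQuantProofs.lean`: the quantitative higher-regularity bounds for bounded
distributional Navier–Stokes solutions, Seregin–Šverák 2009, §2 p. 8 = Serrin's interior regularity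
with constants, proved by the Serrin bootstrap `NSBootstrap*.lean`), which was the last open
hypothesis of each reduction used below.  No statement is changed; each `X_holds : X` turns the
named fact `X` from literature debt into a theorem.
-/

namespace Literature.Analysis.FluidPDE

/-- **Seregin 2014, Lemma 6.1 (all spatial derivatives), proved**: `seregin2014_lemma61` holds — `seregin2014_lemma61_of_lemarieRieusset` (SereginEpsilonRegularityHigherProofs.lean) fed with the proved ε-regularity criterion `lemarieRieusset_epsilon_regularity_holds` (CKNEpsilonRegularityHolds.lean) and `NSBoundedHigherRegularityBounds_holds`.
[cite: Seregin2014, Ch. 6 §6.1 Lemma 6.1 ((6.1.5)–(6.1.6)) with Remark 6.1, PDF p. 90] -/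
theorem seregin2014_lemma61_holds : seregin2014_lemma61 :=
  seregin2014_lemma61_of_lemarieRieusset lemarieRieusset_epsilon_regularity_holds NSBoundedHigherRegularityBounds_holds

end Literature.Analysis.FluidPDE
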